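import Summits.QuantumFields.BalabanUV.T4Continuum.Support.NE7LawLevelAbsorption

/-!
# NE7, ROAD P4 (law-level): ABSORPTION, ℓ¹-IN-BIRTHS FORM (Minkowski over the defects — no depth factor)

(Cell `pub-balaban`, sub-cell `t4`, binder row NE7 = node U5, co-owner #4 `b2b-balaban-t4-ne7-p4`, gen 5; skeleton
`HOME/t4/skeletons/NE7-t4-ne7-p4.md` §2 NODE Q.old (v1.11.2), `HOME/t4/b2b-balaban-t4-ne7-p4/g5/BOOKING-H-NE7-P4.md`
§0′ (d5).  Imports the road's `NE7LawLevelAbsorption` (p215072: `absorption`, the decomposition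
`incr_ae_eq_cfluct_add` of `NE7LawLevelPredictor`, the contraction `sum_integral_incr_sq_le` of `NE7LawLevelLabelled`),
BY NAME.  The improvement typed here was located by the ideation seat `b2b-balaban-t4-ne7-ideate-dimock` (gen 15,
C-ne7idedimock-4, its scratch kernel `AbsorptionL1.lean`): credit recorded.)

HONEST FRAMING (T4-DAG PAGE 1).  Rung (B)+1 on ONE FIXED finite four-torus, CONDITIONAL on `BetaPertH` and the nine
spine estimates (0/9 proved); NOT infinite volume, NOT a mass gap, NOT the Clay problem.  NE7 is NOT PRINTED and NOT
proved here; every theorem below is [folklore] measure theory ∕ finite-sum algebra over plain data, sorry-free; no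
statement of the audited series is asserted or used; NOT summit progress.

WHAT THIS FILE DOES.  `NE7LawLevelAbsorption.absorption` bounds `Σ_{j<d} ∫ (incr S j)²` by
`3Σ∫cfluct² + 3∫resid_0² + 3d·Σ_m ∫defect_m²` — Cauchy–Schwarz over the births costs the depth factor `d`.  MINKOWSKI in
`L²(μ × {j < d})` removes it (§1 `sum_integral_sq_sum_le_sq_sum_sqrt`: `Σ_j ∫ (Σ_i f i j)² ≤ (Σ_i √(Σ_j ∫ (f i j)²))²`),
whence (§2 `absorption_minkowski`)
  `Σ_{j<d} ∫ (incr S j)² ≤ 2·Σ_{j<d} ∫ (A j − μ[A j|F (j+1)])² + 2·(√∫(μ[S|F 0] − A 0)² + Σ_{m<d} √∫(μ[A m|F (m+1)] − A (m+1))²)²`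
— the ℓ¹-in-births form: uniform in the depth when the births' L²-sizes are summable.  (DICTIONARY: in NODE Q.old's count
the depth is the age `n`, a logarithmic quantity, so the `3d` form already sufficed — BOOKING-H §0′ (d5); this is the
better constant, not a new estimate.)  Nothing here is an estimate about Bałaban's chain.
-/

noncomputable section

open MeasureTheory Finset Filter
open scoped BigOperators

namespace Summit.QuantumFields.BalabanUV.T4Continuum.NE7LawLevel

open Literature.MathematicalPhysics.QuantumFieldTheory.Balaban1983to89
open Literature.MathematicalPhysics.QuantumFieldTheory.Balaban1983to89.T4MeanChannel

variable {Ω : Type*} {mΩ : MeasurableSpace Ω} {μ : Measure Ω}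

/-! ## §1 Minkowski over a finite family, two-level form -/

section Minkowski

variable {ι κ : Type*}

/-- `∫ f·g ≤ √∫f² · √∫g²` for a.e.-bounded a.e.-strongly measurable `f`, `g` on a finite measure. [folklore] -/
theorem integral_mul_le_sqrt_mul_sqrt [IsFiniteMeasure μ] {f g : Ω → ℝ} (hfm : AEStronglyMeasurable f μ)
    (hgm : AEStronglyMeasurable g μ) {Rf Rg : ℝ} (hf : ∀ᵐ ω ∂μ, |f ω| ≤ Rf) (hg : ∀ᵐ ω ∂μ, |g ω| ≤ Rg) :
    ∫ ω, f ω * g ω ∂μ ≤ Real.sqrt (∫ ω, f ω ^ 2 ∂μ) * Real.sqrt (∫ ω, g ω ^ 2 ∂μ) := by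
  have hf2 : Integrable (fun ω => f ω ^ 2) μ := integrable_sq_of_ae_abs_le hfm hf
  have hg2 : Integrable (fun ω => g ω ^ 2) μ := integrable_sq_of_ae_abs_le hgm hg
  have hfg : Integrable (fun ω => f ω * g ω) μ :=
    (integrable_of_ae_abs_le hgm hg).bdd_mul hfm (hf.mono fun ω h => by rw [Real.norm_eq_abs]; exact h)
  exact (le_abs_self _).trans (abs_integral_mul_le_sqrt_mul_sqrt_of_integrable hf2 hg2 hfg)

/-- **MINKOWSKI, TWO-LEVEL FORM.**  For a finite family `f i j` of a.e.-bounded functions (`i ∈ s`, `j ∈ t`):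
`Σ_{j∈t} ∫ (Σ_{i∈s} f i j)² ≤ (Σ_{i∈s} √(Σ_{j∈t} ∫ (f i j)²))²` — the triangle inequality in `L²(μ × t)`. [folklore] -/
theorem sum_integral_sq_sum_le_sq_sum_sqrt [IsFiniteMeasure μ] (s : Finset ι) (t : Finset κ) (f : ι → κ → Ω → ℝ)
    (hfm : ∀ i ∈ s, ∀ j ∈ t, AEStronglyMeasurable (f i j) μ) {R : ℝ}
    (hfb : ∀ i ∈ s, ∀ j ∈ t, ∀ᵐ ω ∂μ, |f i j ω| ≤ R) :
    ∑ j ∈ t, ∫ ω, (∑ i ∈ s, f i j ω) ^ 2 ∂μ ≤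
      (∑ i ∈ s, Real.sqrt (∑ j ∈ t, ∫ ω, f i j ω ^ 2 ∂μ)) ^ 2 := by
  have hprod : ∀ j ∈ t, ∀ i ∈ s, ∀ i' ∈ s, Integrable (fun ω => f i j ω * f i' j ω) μ :=
    fun j hj i hi i' hi' => (integrable_of_ae_abs_le (hfm i' hi' j hj) (hfb i' hi' j hj)).bdd_mul (hfm i hi j hj)
      ((hfb i hi j hj).mono fun ω h => by rw [Real.norm_eq_abs]; exact h)
  -- expand the square and integrate termwise
  have hexp : ∀ j ∈ t, ∫ ω, (∑ i ∈ s, f i j ω) ^ 2 ∂μ = ∑ i ∈ s, ∑ i' ∈ s, ∫ ω, f i j ω * f i' j ω ∂μ := by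
    intro j hj
    have hpt : ∀ ω, (∑ i ∈ s, f i j ω) ^ 2 = ∑ i ∈ s, ∑ i' ∈ s, f i j ω * f i' j ω := fun ω => by
      rw [sq, sum_mul_sum]
    simp_rw [hpt]
    rw [integral_finsetSum _ fun i hi => integrable_finsetSum _ fun i' hi' => hprod j hj i hi i' hi']
    exact sum_congr rfl fun i hi => integral_finsetSum _ fun i' hi' => hprod j hj i hi i' hi'
  -- per-pair bound, summed over `j`
  set N : ι → ℝ := fun i => Real.sqrt (∑ j ∈ t, ∫ ω, f i j ω ^ 2 ∂μ) with hN
  have hpair : ∀ i ∈ s, ∀ i' ∈ s, ∑ j ∈ t, ∫ ω, f i j ω * f i' j ω ∂μ ≤ N i * N i' := by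
    intro i hi i' hi'
    calc ∑ j ∈ t, ∫ ω, f i j ω * f i' j ω ∂μ
          ≤ ∑ j ∈ t, Real.sqrt (∫ ω, f i j ω ^ 2 ∂μ) * Real.sqrt (∫ ω, f i' j ω ^ 2 ∂μ) :=
            sum_le_sum fun j hj => integral_mul_le_sqrt_mul_sqrt (hfm i hi j hj) (hfm i' hi' j hj)
              (hfb i hi j hj) (hfb i' hi' j hj)
      _ ≤ Real.sqrt (∑ j ∈ t, ∫ ω, f i j ω ^ 2 ∂μ) * Real.sqrt (∑ j ∈ t, ∫ ω, f i' j ω ^ 2 ∂μ) :=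
            Real.sum_sqrt_mul_sqrt_le t (fun j => integral_nonneg fun ω => sq_nonneg _)
              (fun j => integral_nonneg fun ω => sq_nonneg _)
  calc ∑ j ∈ t, ∫ ω, (∑ i ∈ s, f i j ω) ^ 2 ∂μ
        = ∑ j ∈ t, ∑ i ∈ s, ∑ i' ∈ s, ∫ ω, f i j ω * f i' j ω ∂μ := sum_congr rfl hexp
    _ = ∑ i ∈ s, ∑ i' ∈ s, ∑ j ∈ t, ∫ ω, f i j ω * f i' j ω ∂μ := by
          rw [sum_comm]; exact sum_congr rfl fun i _ => sum_comm
    _ ≤ ∑ i ∈ s, ∑ i' ∈ s, N i * N i' := sum_le_sum fun i hi => sum_le_sum fun i' hi' => hpair i hi i' hi'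
    _ = (∑ i ∈ s, N i) ^ 2 := by rw [sq, sum_mul_sum]

end Minkowski

/-! ## §2 Absorption, ℓ¹-in-births form -/

section AbsorptionL1

variable {F : ℕ → MeasurableSpace Ω} (hF : Antitone F) (hFle : ∀ j, F j ≤ mΩ) {S : Ω → ℝ} {B : ℝ}
  (hSb : ∀ ω, |S ω| ≤ B) {A : ℕ → Ω → ℝ} (hAm : ∀ j, StronglyMeasurable[F j] (A j)) {R : ℝ}
  (hAb : ∀ j ω, |A j ω| ≤ R)

include hF hFle hSb hAm hAb in
/-- **ABSORPTION, ℓ¹-IN-BIRTHS FORM (no depth factor).**  For every depth `d`: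
`Σ_{j<d} ∫ (incr S j)² ≤ 2·Σ_{j<d} ∫ (A j − μ[A j|F (j+1)])² + 2·(√∫(μ[S|F 0] − A 0)² + Σ_{m<d} √∫(μ[A m|F (m+1)] − A (m+1))²)²`.
Compared with `absorption` (`… + 3∫resid_0² + 3d·Σ_m∫defect_m²`), Minkowski over the births replaces Cauchy–Schwarz:
the bound is uniform in `d` whenever `Σ_m √∫defect_m² < ∞`. [folklore] -/
theorem absorption_minkowski [IsFiniteMeasure μ] (d : ℕ) :
    ∑ j ∈ range d, ∫ ω, incr μ F S j ω ^ 2 ∂μ ≤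
      2 * ∑ j ∈ range d, ∫ ω, (A j - μ[A j|F (j + 1)]) ω ^ 2 ∂μ +
      2 * (Real.sqrt (∫ ω, (μ[S|F 0] - A 0) ω ^ 2 ∂μ) +
            ∑ m ∈ range d, Real.sqrt (∫ ω, (μ[A m|F (m + 1)] - A (m + 1)) ω ^ 2 ∂μ)) ^ 2 := by
  -- the martingale family: index 0 ↦ the initial residual, index m+1 ↦ the defect born at layer m+1 (cut to m < j)
  set g : ℕ → ℕ → Ω → ℝ := fun i j =>
    match i with
    | 0 => incr μ F (μ[S|F 0] - A 0) j
    | m + 1 => if m < j then incr μ F (μ[A m|F (m + 1)] - A (m + 1)) j else 0 with hg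
  have hg0 : ∀ j, g 0 j = incr μ F (μ[S|F 0] - A 0) j := fun j => rfl
  have hgs : ∀ m j, g (m + 1) j = if m < j then incr μ F (μ[A m|F (m + 1)] - A (m + 1)) j else 0 := fun m j => rfl
  -- a.e. bounds and measurability of the family
  have hres : ∀ᵐ ω ∂μ, |(μ[S|F 0] - A 0) ω| ≤ B + R := ae_abs_resid_zero_le hSb hAb
  have hdef : ∀ m, ∀ᵐ ω ∂μ, |(μ[A m|F (m + 1)] - A (m + 1)) ω| ≤ 2 * R := fun m => ae_abs_defect_le hAb m
  have hgm : ∀ i j, AEStronglyMeasurable (g i j) μ := by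
    intro i j
    cases i with
    | zero => rw [hg0]; exact aestronglyMeasurable_incr hF hFle _ j
    | succ m =>
      rw [hgs]; split_ifs
      · exact aestronglyMeasurable_incr hF hFle _ j
      · exact aestronglyMeasurable_const
  have hgb : ∀ i j, ∀ᵐ ω ∂μ, |g i j ω| ≤ 2 * (|B| + |R|) + 4 * |R| := by
    intro i j
    cases i with
    | zero =>
      filter_upwards [ae_abs_incr_le_of_ae hres j] with ω h
      rw [hg0]; linarith [le_abs_self B, le_abs_self R, abs_nonneg R]
    | succ m =>
      filter_upwards [ae_abs_incr_le_of_ae (hdef m) j] with ω h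
      rw [hgs]; split_ifs
      · linarith [le_abs_self R, abs_nonneg B, abs_nonneg R]
      · simp only [Pi.zero_apply, abs_zero]; positivity
  -- the increment identity: incr S j = cfluct j + Σ_{i < d+1} g i j  (a.e., for j < d)
  have hsum : ∀ j, j ≤ d → ∀ ω, ∑ i ∈ range (d + 1), g i j ω =
      incr μ F (μ[S|F 0] - A 0) j ω + ∑ m ∈ range j, incr μ F (μ[A m|F (m + 1)] - A (m + 1)) j ω := by
    intro j hjd ω
    rw [sum_range_succ', hg0, add_comm]
    congr 1
    have hfilt : ∑ m ∈ range d, g (m + 1) j ω =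
        ∑ m ∈ (range d).filter (fun m => m < j), incr μ F (μ[A m|F (m + 1)] - A (m + 1)) j ω := by
      rw [sum_filter]
      refine sum_congr rfl fun m _ => ?_
      rw [hgs]; split_ifs <;> rfl
    rw [hfilt]
    congr 1
    ext m; simp only [mem_filter, mem_range]; omega
  -- one layer: ∫ (incr S j)² ≤ 2∫cfluct_j² + 2∫(Σ_i g i j)²
  have hIa : ∀ j, Integrable (fun ω => (A j - μ[A j|F (j + 1)]) ω ^ 2) μ := fun j =>
    integrable_sq_of_ae_abs_le (((hAm j).mono (hFle j)).aestronglyMeasurable.sub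
      (stronglyMeasurable_condExp.mono (hFle (j + 1))).aestronglyMeasurable) (ae_abs_cfluct_le hAb j)
  have hGm : ∀ j, AEStronglyMeasurable (fun ω => ∑ i ∈ range (d + 1), g i j ω) μ := fun j => by
    have h := Finset.aestronglyMeasurable_sum (range (d + 1)) (f := fun i => g i j) (fun i _ => hgm i j)
    have heq : (∑ i ∈ range (d + 1), g i j) = fun ω => ∑ i ∈ range (d + 1), g i j ω := by
      funext ω; exact Finset.sum_apply ω (range (d + 1)) (fun i => g i j)
    rwa [heq] at h
  have hIG : ∀ j, Integrable (fun ω => (∑ i ∈ range (d + 1), g i j ω) ^ 2) μ := fun j =>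
    integrable_sq_of_ae_abs_le (hGm j)
      (bu := ∑ i ∈ range (d + 1), (2 * (|B| + |R|) + 4 * |R|)) (by
        have hall : ∀ᵐ ω ∂μ, ∀ i ∈ range (d + 1), |g i j ω| ≤ 2 * (|B| + |R|) + 4 * |R| :=
          (eventually_all_finset _).mpr fun i _ => hgb i j
        filter_upwards [hall] with ω h
        exact (abs_sum_le_sum_abs _ _).trans (sum_le_sum h))
  have hlayer : ∀ j ∈ range d, ∫ ω, incr μ F S j ω ^ 2 ∂μ ≤
      2 * ∫ ω, (A j - μ[A j|F (j + 1)]) ω ^ 2 ∂μ + 2 * ∫ ω, (∑ i ∈ range (d + 1), g i j ω) ^ 2 ∂μ := by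
    intro j hj
    have hjd : j ≤ d := (mem_range.mp hj).le
    have hIS : Integrable (fun ω => incr μ F S j ω ^ 2) μ :=
      integrable_sq_of_ae_abs_le (aestronglyMeasurable_incr hF hFle _ j) (ae_abs_incr_le hSb j)
    have hpt : ∀ᵐ ω ∂μ, incr μ F S j ω ^ 2 ≤
        2 * (A j - μ[A j|F (j + 1)]) ω ^ 2 + 2 * (∑ i ∈ range (d + 1), g i j ω) ^ 2 := by
      filter_upwards [incr_ae_eq_cfluct_add (μ := μ) (S := S) hF hFle hAm hAb j] with ω e
      rw [e, Pi.add_apply, Pi.add_apply, Finset.sum_apply, hsum j hjd ω]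
      nlinarith [sq_nonneg ((A j - μ[A j|F (j + 1)]) ω - (incr μ F (μ[S|F 0] - A 0) j ω +
        ∑ m ∈ range j, incr μ F (μ[A m|F (m + 1)] - A (m + 1)) j ω))]
    calc ∫ ω, incr μ F S j ω ^ 2 ∂μ
          ≤ ∫ ω, (2 * (A j - μ[A j|F (j + 1)]) ω ^ 2 + 2 * (∑ i ∈ range (d + 1), g i j ω) ^ 2) ∂μ :=
            integral_mono_ae hIS (((hIa j).const_mul 2).add ((hIG j).const_mul 2)) hpt
      _ = 2 * ∫ ω, (A j - μ[A j|F (j + 1)]) ω ^ 2 ∂μ + 2 * ∫ ω, (∑ i ∈ range (d + 1), g i j ω) ^ 2 ∂μ := by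
            have e1 : ∫ ω, (2 * (A j - μ[A j|F (j + 1)]) ω ^ 2 + 2 * (∑ i ∈ range (d + 1), g i j ω) ^ 2) ∂μ =
                ∫ ω, 2 * (A j - μ[A j|F (j + 1)]) ω ^ 2 ∂μ + ∫ ω, 2 * (∑ i ∈ range (d + 1), g i j ω) ^ 2 ∂μ :=
              integral_add ((hIa j).const_mul 2) ((hIG j).const_mul 2)
            rw [e1, integral_const_mul, integral_const_mul]
  -- Minkowski over the family, then contraction of each member
  have hMink := sum_integral_sq_sum_le_sq_sum_sqrt (μ := μ) (range (d + 1)) (range d) g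
    (fun i _ j _ => hgm i j) (fun i _ j _ => hgb i j)
  have hN0 : Real.sqrt (∑ j ∈ range d, ∫ ω, g 0 j ω ^ 2 ∂μ) ≤
      Real.sqrt (∫ ω, (μ[S|F 0] - A 0) ω ^ 2 ∂μ) := by
    refine Real.sqrt_le_sqrt ?_
    simp only [hg0]
    exact sum_integral_incr_sq_le hF hFle
      ((stronglyMeasurable_resid hAm 0).mono (hFle 0)).aestronglyMeasurable hres d
  have hNs : ∀ m ∈ range d, Real.sqrt (∑ j ∈ range d, ∫ ω, g (m + 1) j ω ^ 2 ∂μ) ≤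
      Real.sqrt (∫ ω, (μ[A m|F (m + 1)] - A (m + 1)) ω ^ 2 ∂μ) := by
    intro m _
    refine Real.sqrt_le_sqrt ?_
    calc ∑ j ∈ range d, ∫ ω, g (m + 1) j ω ^ 2 ∂μ
          ≤ ∑ j ∈ range d, ∫ ω, incr μ F (μ[A m|F (m + 1)] - A (m + 1)) j ω ^ 2 ∂μ :=
            sum_le_sum fun j _ => by
              rw [hgs]; split_ifs
              · exact le_rfl
              · have h0 : (fun ω => (0 : Ω → ℝ) ω ^ 2) = fun _ => (0 : ℝ) := by
                  funext ω; simp only [Pi.zero_apply, ne_eq, OfNat.ofNat_ne_zero, not_false_eq_true, zero_pow]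
                rw [h0, integral_zero]
                exact integral_nonneg fun ω => sq_nonneg _
      _ ≤ ∫ ω, (μ[A m|F (m + 1)] - A (m + 1)) ω ^ 2 ∂μ :=
            sum_integral_incr_sq_le hF hFle
              ((stronglyMeasurable_defect hAm m).mono (hFle (m + 1))).aestronglyMeasurable (hdef m) d
  have hsqrt_sum : ∑ i ∈ range (d + 1), Real.sqrt (∑ j ∈ range d, ∫ ω, g i j ω ^ 2 ∂μ) ≤
      Real.sqrt (∫ ω, (μ[S|F 0] - A 0) ω ^ 2 ∂μ) +
        ∑ m ∈ range d, Real.sqrt (∫ ω, (μ[A m|F (m + 1)] - A (m + 1)) ω ^ 2 ∂μ) := by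
    rw [sum_range_succ', add_comm]
    exact add_le_add hN0 (sum_le_sum hNs)
  have hnn1 : 0 ≤ ∑ i ∈ range (d + 1), Real.sqrt (∑ j ∈ range d, ∫ ω, g i j ω ^ 2 ∂μ) :=
    sum_nonneg fun i _ => Real.sqrt_nonneg _
  calc ∑ j ∈ range d, ∫ ω, incr μ F S j ω ^ 2 ∂μ
        ≤ ∑ j ∈ range d, (2 * ∫ ω, (A j - μ[A j|F (j + 1)]) ω ^ 2 ∂μ +
            2 * ∫ ω, (∑ i ∈ range (d + 1), g i j ω) ^ 2 ∂μ) := sum_le_sum hlayer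
    _ = 2 * ∑ j ∈ range d, ∫ ω, (A j - μ[A j|F (j + 1)]) ω ^ 2 ∂μ +
          2 * ∑ j ∈ range d, ∫ ω, (∑ i ∈ range (d + 1), g i j ω) ^ 2 ∂μ := by
          rw [sum_add_distrib, mul_sum, mul_sum]
    _ ≤ 2 * ∑ j ∈ range d, ∫ ω, (A j - μ[A j|F (j + 1)]) ω ^ 2 ∂μ +
          2 * (∑ i ∈ range (d + 1), Real.sqrt (∑ j ∈ range d, ∫ ω, g i j ω ^ 2 ∂μ)) ^ 2 := by
          linarith [hMink]
    _ ≤ _ := by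
          have h2 := pow_le_pow_left₀ hnn1 hsqrt_sum 2
          linarith [h2]

end AbsorptionL1

end Summit.QuantumFields.BalabanUV.T4Continuum.NE7LawLevel

end
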